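import Literature.Analysis.FluidPDE.StationaryEulerLaminateWaves
import Literature.Analysis.FluidPDE.StationaryEulerTorusBlocks
import HarnessLib

/-!
# Tools for stub `stub_pressurelessPacket` — the packet pressure of placed and rescaled packets
(crux `PointSink.PointFluxCone`, stmt-AnomalousDissipation-19033, line `Sketch`)

Bookkeeping for the packet pressure `prC P = Σ_τ (Σ_m S_τ[φ_τ]_{mm}) / d`
(`Literature/Analysis/FluidPDE/StationaryEulerTorusBlocks`) under the operations used by the
realization of laminates (`Literature/Analysis/FluidPDE/StationaryEulerLaminateWaves`, Prop. 6 of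
Choffrut–Székelyhidi 2014): concatenation, rescaling `φ ↦ s² φ(s⁻¹(x - x₀))` (which preserves second
derivatives, hence sup bounds of `prC`), and placement of rescaled copies on disjoint grid cubes
(`placed`): a uniform bound `|prC Q| ≤ b` of the copies is inherited by the placed packet.

References: A. Choffrut, L. Székelyhidi Jr., *Weak solutions to the stationary incompressible
Euler equations*, SIAM J. Math. Anal. 46 (2014), Lemma 3, Prop. 6.
-/

noncomputable section

open scoped InnerProductSpace ContDiff ENNReal Topology
open Set Function MeasureTheory Metric Filter
open Literature.Analysis.FluidPDE Literature.Analysis.FluidPDE.StationaryEuler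
open Literature.Analysis.FunctionSpaces

set_option linter.dupNamespace false

namespace Summit.AnomalousDissipation.AnomalousDissipation.Theorems

/-! ## The packet pressure under concatenation and rescaling -/

/-- The packet pressure is additive over concatenation. [folklore] -/
theorem pressurelessPacket_prC_append {d : Type*} [Fintype d] [DecidableEq d] (P P' : Packet d)
    (x : Ed d) : Packet.prC (P ++ P') x = Packet.prC P x + Packet.prC P' x := by
  simp [Packet.prC, List.map_append, List.sum_append]

/-- The stress potential of a rescaled potential is the transported stress potential (second
derivatives are homogeneous of order two under `φ ↦ s² φ(s⁻¹(x - x₀))`). [folklore] -/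
theorem pressurelessPacket_strS_rescale {d : Type*} [Fintype d] [DecidableEq d] (c : WaveCert d)
    {φ : Ed d → ℝ} (hφ : ContDiff ℝ ∞ φ) (x₀ : Ed d) {s : ℝ} (hs : s ≠ 0) (i j : d) (x : Ed d) :
    c.strS (WaveCert.rescale x₀ s φ) i j x = c.strS φ i j (s⁻¹ • (x - x₀)) := by
  -- adapted from Literature/Analysis/FluidPDE/StationaryEulerWavePackets (WaveCert.field_rescale)
  have key : ∀ k l, pd (eb k) (pd (eb l) (WaveCert.rescale x₀ s φ)) x =
      pd (eb k) (pd (eb l) φ) (s⁻¹ • (x - x₀)) :=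
    fun k l => congrFun (WaveCert.pd_pd_rescale hφ x₀ hs _ _) x
  simp only [WaveCert.strS, key]

/-- **The packet pressure of a rescaled packet**: `prC (rescale x₀ s P) x = prC P ((x - x₀)/s)`.
[folklore] -/
theorem pressurelessPacket_prC_rescale {d : Type*} [Fintype d] [DecidableEq d] (x₀ : Ed d) {s : ℝ}
    (hs : s ≠ 0) (P : Packet d) (x : Ed d) :
    Packet.prC (Packet.rescale x₀ s hs P) x = Packet.prC P (s⁻¹ • (x - x₀)) := by
  -- adapted from Literature/Analysis/FluidPDE/StationaryEulerWavePackets (Packet.field_rescale)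
  induction P with
  | nil => rfl
  | cons τ P ih =>
    simp only [Packet.rescale, List.map_cons, Packet.prC_cons] at ih ⊢
    rw [ih]
    simp only [WaveTerm.rescale, pressurelessPacket_strS_rescale τ.cert τ.smooth x₀ hs]

/-- The packet pressure of a `flatMap` of packets. [folklore] -/
theorem pressurelessPacket_prC_flatMap {d : Type*} [Fintype d] [DecidableEq d] {ι : Type*}
    (L : List ι) (f : ι → Packet d) (x : Ed d) :
    Packet.prC (L.flatMap f) x = (L.map fun i => Packet.prC (f i) x).sum := by
  -- adapted from Literature/Analysis/FluidPDE/StationaryEulerLaminateWaves (field_flatMap)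
  induction L with
  | nil => rfl
  | cons i L ih =>
    rw [List.flatMap_cons, pressurelessPacket_prC_append, ih, List.map_cons, List.sum_cons]

/-! ## The packet pressure of placed copies -/

/-- **Pressure of the placed packet**: `Σ_{κ ∈ S} prC (Q κ) (m (x - corner κ))`. [folklore] -/
theorem pressurelessPacket_prC_placed {d : Type*} [Fintype d] [DecidableEq d]
    (F : Ed d ≃ₗᵢ[ℝ] Ed d) {m : ℕ} (hm : 0 < m) (S : Finset (d → ℤ)) (Q : (d → ℤ) → Packet d)
    (x : Ed d) :
    Packet.prC (placed F hm S Q) x = ∑ κ ∈ S, Packet.prC (Q κ) ((m : ℝ) • (x - corner F m κ)) := by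
  -- adapted from Literature/Analysis/FluidPDE/StationaryEulerLaminateWaves (field_placed)
  rw [placed, pressurelessPacket_prC_flatMap]
  simp only [pressurelessPacket_prC_rescale, inv_inv, Finset.sum_map_toList]

/-- The pressure of a rescaled copy vanishes off its cube. [folklore] -/
theorem pressurelessPacket_prC_rescale_eq_zero {d : Type*} [Fintype d] [DecidableEq d]
    (F : Ed d ≃ₗᵢ[ℝ] Ed d) {m : ℕ} (hm : 0 < m) {Q : Packet d} (hQ : Packet.SuppIn (refCube F) Q)
    {κ : d → ℤ} {x : Ed d} (hx : x ∉ acube F m κ) :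
    Packet.prC Q ((m : ℝ) • (x - corner F m κ)) = 0 := by
  -- adapted from Literature/Analysis/FluidPDE/StationaryEulerLaminateWaves (field_rescale_eq_zero)
  have h := Packet.prC_eq_zero (suppIn_rescale_acube F hm hQ κ) hx
  rwa [pressurelessPacket_prC_rescale, inv_inv] at h

/-- **On the cube `κ₀` the placed pressure is that of the single copy `κ₀`.** [folklore] -/
theorem pressurelessPacket_prC_placed_of_mem {d : Type*} [Fintype d] [DecidableEq d]
    (F : Ed d ≃ₗᵢ[ℝ] Ed d) {m : ℕ} (hm : 0 < m) (S : Finset (d → ℤ)) {Q : (d → ℤ) → Packet d}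
    (hQ : ∀ κ ∈ S, Packet.SuppIn (refCube F) (Q κ)) {κ₀ : d → ℤ} (hκ₀ : κ₀ ∈ S) {x : Ed d}
    (hx : x ∈ acube F m κ₀) :
    Packet.prC (placed F hm S Q) x = Packet.prC (Q κ₀) ((m : ℝ) • (x - corner F m κ₀)) := by
  -- adapted from Literature/Analysis/FluidPDE/StationaryEulerLaminateWaves (field_placed_of_mem)
  rw [pressurelessPacket_prC_placed, Finset.sum_eq_single_of_mem κ₀ hκ₀]
  intro κ hκS hκ
  exact pressurelessPacket_prC_rescale_eq_zero F hm (hQ κ hκS) fun h =>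
    (disjoint_acube hm hκ).ne_of_mem h hx rfl

/-- Off the cubes the placed pressure vanishes. [folklore] -/
theorem pressurelessPacket_prC_placed_of_not_mem {d : Type*} [Fintype d] [DecidableEq d]
    (F : Ed d ≃ₗᵢ[ℝ] Ed d) {m : ℕ} (hm : 0 < m) (S : Finset (d → ℤ)) {Q : (d → ℤ) → Packet d}
    (hQ : ∀ κ ∈ S, Packet.SuppIn (refCube F) (Q κ)) {x : Ed d} (hx : ∀ κ ∈ S, x ∉ acube F m κ) :
    Packet.prC (placed F hm S Q) x = 0 := by
  -- adapted from Literature/Analysis/FluidPDE/StationaryEulerLaminateWaves (field_placed_of_not_mem)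
  rw [pressurelessPacket_prC_placed]
  exact Finset.sum_eq_zero fun κ hκ => pressurelessPacket_prC_rescale_eq_zero F hm (hQ κ hκ) (hx κ hκ)

/-- **Sup bounds of the pressure are inherited by the placed packet**: if every copy has
`|prC (Q κ)| ≤ b` everywhere (`b ≥ 0`), then `|prC (placed F hm S Q)| ≤ b` everywhere (the cubes
are disjoint, so at every point at most one copy contributes). [folklore] -/
theorem pressurelessPacket_abs_prC_placed_le {d : Type*} [Fintype d] [DecidableEq d]
    (F : Ed d ≃ₗᵢ[ℝ] Ed d) {m : ℕ} (hm : 0 < m) (S : Finset (d → ℤ)) {Q : (d → ℤ) → Packet d}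
    (hQ : ∀ κ ∈ S, Packet.SuppIn (refCube F) (Q κ)) {b : ℝ} (hb0 : 0 ≤ b)
    (hb : ∀ κ ∈ S, ∀ y, |Packet.prC (Q κ) y| ≤ b) (x : Ed d) :
    |Packet.prC (placed F hm S Q) x| ≤ b := by
  by_cases h : ∃ κ ∈ S, x ∈ acube F m κ
  · obtain ⟨κ₀, hκ₀, hx⟩ := h
    rw [pressurelessPacket_prC_placed_of_mem F hm S hQ hκ₀ hx]
    exact hb κ₀ hκ₀ _
  · push Not at h
    rw [pressurelessPacket_prC_placed_of_not_mem F hm S hQ h, abs_zero]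
    exact hb0

/-- **The pressure of a single wave term** is `(Σ_m S[φ]_{mm}) / d`, so a bound `b` of the trace of
the stress potential bounds `|prC [τ]|` by `b` (`d ≥ 1`). [folklore] -/
theorem pressurelessPacket_abs_prC_single_le {d : Type*} [Fintype d] [DecidableEq d] [Nonempty d]
    (τ : WaveTerm d) (x : Ed d) {b : ℝ} (h : |∑ m, τ.cert.strS τ.φ m m x| ≤ b) :
    |Packet.prC [τ] x| ≤ b := by
  rw [Packet.prC_cons, Packet.prC_nil, add_zero, abs_div, Nat.abs_cast]
  exact (div_le_self (abs_nonneg _) (Nat.one_le_cast.2 Fintype.card_pos)).trans h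

/-- **The certificate of a pressureless split is trace free**: for `q = 0` the matrix
`S̄ = str (z_r - z_l) + q • 1` of `certOfSplit` has trace `tr str (z_r - z_l) = 0` (admissibility).
[cite: ChoffrutSzekelyhidi2014, (3.1), Def. 5] -/
theorem pressurelessPacket_trace_certOfSplit {d : Type*} [Fintype d] [DecidableEq d]
    {U : Set (State d)} {t : ℝ} {η : Ed d} {q : ℝ} {l r : Laminate d}
    (h : (Laminate.split t η q l r).IsValid U) (hadm : IsAdm (r.bary - l.bary)) (hq : q = 0) :
    (certOfSplit h hadm).S.trace = 0 := by
  show (str (r.bary - l.bary) + q • (1 : Matrix d d ℝ)).trace = 0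
  rw [hq, zero_smul, add_zero]
  exact hadm.2

/-- **Tools conjunction** (registered sub-stub `stub_pressurelessPacketTools` of
stmt-AnomalousDissipation-19033): additivity of the packet pressure over concatenation, its
transport under rescaling, the inherited sup bound for placed packets, the single-term bound, and
the trace-freeness of pressureless split certificates, in `ℝ³`. [folklore] -/
theorem stub_pressurelessPacketTools :
    (∀ (P P' : Packet (Fin 3)) (x : Ed (Fin 3)),
      Packet.prC (P ++ P') x = Packet.prC P x + Packet.prC P' x) ∧
    (∀ (x₀ : Ed (Fin 3)) (s : ℝ) (hs : s ≠ 0) (P : Packet (Fin 3)) (x : Ed (Fin 3)),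
      Packet.prC (Packet.rescale x₀ s hs P) x = Packet.prC P (s⁻¹ • (x - x₀))) ∧
    (∀ (F : Ed (Fin 3) ≃ₗᵢ[ℝ] Ed (Fin 3)) (m : ℕ) (hm : 0 < m) (S : Finset (Fin 3 → ℤ))
      (Q : (Fin 3 → ℤ) → Packet (Fin 3)), (∀ κ ∈ S, Packet.SuppIn (refCube F) (Q κ)) →
      ∀ (b : ℝ), 0 ≤ b → (∀ κ ∈ S, ∀ y, |Packet.prC (Q κ) y| ≤ b) →
      ∀ x, |Packet.prC (placed F hm S Q) x| ≤ b) ∧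
    (∀ (τ : WaveTerm (Fin 3)) (x : Ed (Fin 3)) (b : ℝ), |∑ m, τ.cert.strS τ.φ m m x| ≤ b →
      |Packet.prC [τ] x| ≤ b) ∧
    (∀ (U : Set (State (Fin 3))) (t : ℝ) (η : Ed (Fin 3)) (q : ℝ) (l r : Laminate (Fin 3))
      (h : (Laminate.split t η q l r).IsValid U) (hadm : IsAdm (r.bary - l.bary)), q = 0 →
      (certOfSplit h hadm).S.trace = 0) :=
  ⟨pressurelessPacket_prC_append, fun x₀ _ hs P x => pressurelessPacket_prC_rescale x₀ hs P x,
    fun F _ hm S _ hQ _ hb0 hb x => pressurelessPacket_abs_prC_placed_le F hm S hQ hb0 hb x,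
    fun τ x _ h => pressurelessPacket_abs_prC_single_le τ x h,
    fun _ _ _ _ _ _ h hadm hq => pressurelessPacket_trace_certOfSplit h hadm hq⟩

end Summit.AnomalousDissipation.AnomalousDissipation.Theorems
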